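import Mathlib
import Summits.AtomisticToContinuum.Crystallization.Theses.ChessboardParticlePlanes
import Literature.MathematicalPhysics.StatisticalMechanics.BarlowStacking
import Literature.MathematicalPhysics.StatisticalMechanics.LennardJonesClusters

/-!
# Sketch — crux ideas for `ChessboardParticlePlanes.LjLaminarWindows` (stmt-AtomisticToContinuum-6711)

Ideator 1, round 1 (2026-08-16).  First lemmas of the two idea cards, typed over existing
declarations; nothing here is proved (statements only), everything must elaborate.

* §A  card `stacking-blind-budget-flatness`: `GoodSetBudget` (first lemma, provable now),
  `RigidOptimalBarlowWindows` (the output format of the line) and `WindowsGlue`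
  (bookkeeping implication onto the crux decl).
* §B  card `epitaxial-half-space-gap`: `HollowGap` (first lemma, certified one-centre
  inequality), `HalfSpaceEpitaxialGap` (the load-bearing slab inequality, grand-canonical form
  with one-body coercivity) and `SeedLayers` (the bet).
-/

noncomputable section

open scoped BigOperators
open Filter Literature.MathematicalPhysics.StatisticalMechanics

namespace Summit.AtomisticToContinuum.Crystallization.Cruxes.LjLaminarWindows.IdeatorOne

local notation "E3" => EuclideanSpace ℝ (Fin 3)

/-- The periodic infimum `e* = ⨅_Q e(Q)` of the Lennard-Jones energy per particle (the constant
in the crux's energy clause). -/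
def eStar : ℝ := ⨅ Q : PeriodicConfiguration 3, Q.energyPerParticle lennardJones

/-! ## §A — stacking-blind good-set budget -/

/-- GOOD-SET BUDGET, stacking-blind form (first lemma of card `stacking-blind-budget-flatness`;
provable now from `crysEnergyUpper_proof`, `two_mul_interactionEnergy`,
`LennardJonesMinimalDistance_holds` + `sum_inv_pow_six_le`): along Lennard-Jones ground states,
for ANY choice of "good" sets whose complements have density `→ 0`, the summed site excess
`½𝓔ⁱ − e*` over the good set is `o(N)`.  No minimality of any Barlow stacking is used
(`e* ≤ e(Q)` for every periodic `Q` is the trivial direction). -/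
def GoodSetBudget : Prop :=
  ∀ x : (N : ℕ) → (Fin N → E3), (∀ N, IsGroundState lennardJones (x N)) →
    ∀ good : (N : ℕ) → Finset (Fin N),
      Tendsto (fun N : ℕ => ((N : ℝ) - ((good N).card : ℝ)) / N) atTop (nhds 0) →
        ∀ θ : ℝ, 0 < θ → ∀ᶠ N : ℕ in atTop,
          ∑ i ∈ good N, ((1 / 2 : ℝ) * siteEnergy lennardJones (x N) i - eStar) ≤ θ * N

/-- RIGID NEAR-OPTIMAL BARLOW WINDOWS (the output of the line): for every radius `R` and
tolerance `ε`, frequently in `N`, some particle `i` carries a window two-way `ε`-matched to a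
RIGID image of a Barlow stacking `barlowStacking a h s` (ANY Hägg word `s`; `a ∈ [0.95, 1]`,
`h ∈ [3/4, 9/10]`) centred at `x_i`, whose internal energy is `≤ 2(e* + ε)·#window`. -/
def RigidOptimalBarlowWindows : Prop :=
  ∀ x : (N : ℕ) → (Fin N → E3), (∀ N, IsGroundState lennardJones (x N)) →
    ∀ R ε : ℝ, 0 < R → 0 < ε → ∃ᶠ N in atTop,
      ∃ (i : Fin N) (g : E3 ≃ᵃⁱ[ℝ] E3) (a h : ℝ) (s : ℤ → ℤ),
        19 / 20 ≤ a ∧ a ≤ 1 ∧ 3 / 4 ≤ h ∧ h ≤ 9 / 10 ∧ IsHaggSeq s ∧ g 0 = x N i ∧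
        (∀ z ∈ barlowStacking a h s, dist (g z) (x N i) ≤ R → ∃ j : Fin N, dist (x N j) (g z) ≤ ε) ∧
        (∀ j : Fin N, dist (x N j) (x N i) ≤ R → ∃ z ∈ barlowStacking a h s, dist (x N j) (g z) ≤ ε) ∧
        (∑ j : Fin N, ∑ k : Fin N,
            if j ≠ k ∧ dist (x N j) (x N i) ≤ R ∧ dist (x N k) (x N i) ≤ R
            then lennardJones (dist (x N j) (x N k)) else 0)
          ≤ 2 * (eStar + ε) * (Nat.card {j : Fin N // dist (x N j) (x N i) ≤ R} : ℝ)

/-- WINDOWS GLUE (bookkeeping, provable now): rigid near-optimal Barlow windows of any word are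
laminar windows in the sense of the crux (`T = h ℤ` read along the third axis of `g⁻¹`,
`A` = linear part of `g⁻¹`; 7/10-separation from `le_dist_of_mem_barlowStacking` and
`LennardJonesMinimalDistance_holds` once `2ε < δ`; the energy clause is carried). -/
def WindowsGlue : Prop :=
  RigidOptimalBarlowWindows →
    Summit.AtomisticToContinuum.Crystallization.Theses.ChessboardParticlePlanes.LjLaminarWindows

/-! ## §B — epitaxy above a rigid close-packed layer -/

/-- The rigid triangular layer of spacing `a` in the plane `x₂ = 0`. -/
def layer (a : ℝ) : Set E3 :=
  {z | ∃ i j : ℤ, z = (i : ℝ) • triangularVec₁ a + (j : ℝ) • triangularVec₂ a}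

/-- Its hollow (deep-hole) sites of both letters, `w + Λ` and `2w + Λ`, `w = barlowOffset a`. -/
def hollows (a : ℝ) : Set E3 :=
  {p | ∃ (m i j : ℤ), (m = 1 ∨ m = 2) ∧
      p = (m : ℝ) • barlowOffset a + (i : ℝ) • triangularVec₁ a + (j : ℝ) • triangularVec₂ a}

/-- Vertical projection onto the plane `x₂ = 0`. -/
def proj (p : E3) : E3 := p - (p 2) • EuclideanSpace.single (2 : Fin 3) (1 : ℝ)

/-- Adsorption potential of the rigid layer at `p` (a `tsum`; absolutely summable for `p ∉ layer`). -/
def adsorption (a : ℝ) (p : E3) : ℝ := ∑' z : layer a, lennardJones (dist p (z : E3))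

/-- Half the in-plane lattice sum, `e₂(a) = ½ ∑_{z ∈ Λ_a ∖ 0} V(|z|)` (the in-plane share of a
registered overlayer atom). -/
def inplaneHalfSum (a : ℝ) : ℝ :=
  (1 / 2) * ∑' z : {z : E3 // z ∈ layer a ∧ z ≠ 0}, lennardJones ‖(z : E3)‖

/-- HOLLOW GAP (first lemma of card `epitaxial-half-space-gap`; a certified one-centre
inequality): above a rigid triangular Lennard-Jones layer of spacing `a ∈ [0.95, 1]`, a particle
kept `≥ 7/10` from the layer and laterally `≥ a/4` from every hollow site has adsorption energy at
least `1/80` above the minimum (numerics, this seat: bridge `+0.0275`, atop `+0.120`, lateral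
curvature at the hollow `≈ 3.2`, minimum `−0.3767` at height `0.811` for `a = 0.9712`). -/
def HollowGap : Prop :=
  ∀ a : ℝ, 19 / 20 ≤ a → a ≤ 1 → ∀ p : E3, 0 < p 2 → (∀ z ∈ layer a, 7 / 10 ≤ dist p z) →
    a / 4 ≤ Metric.infDist (proj p) (hollows a) →
      (⨅ q : {q : E3 // 0 < q 2 ∧ ∀ z ∈ layer a, 7 / 10 ≤ dist q z}, adsorption a q.1) + 1 / 80
        ≤ adsorption a p

/-- HALF-SPACE EPITAXIAL GAP (the load-bearing slab inequality, grand-canonical form): there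
are `κ, c > 0` and `C` such that for every `a ∈ [0.95, 1]` there are a registered height
`hₐ ≥ 3/4` and the adsorption minimum `w₀` with: for every finite overlayer configuration `y` in
the slab `0 < y₂ ≤ 3/2` over the disc of radius `ρ`, pairwise and from the layer `≥ 7/10` apart,
`∑ᵢ W(yᵢ) + 𝓔(y) ≥ n·(w₀ + e₂(a)) − C ρ + κ·#(unregistered sites) + c·∑_{registered} dev²` —
the registered triangular overlayer is the ground state of the slab at chemical potential
`w₀ + e₂(a)`, with a gap for sites off the hollow wells and ONE-BODY (Einstein) coercivity for
the others.  Frustration-free: the substrate pins orientation and spacing; the hollow letter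
(stacking) is free and never charged. -/
def HalfSpaceEpitaxialGap : Prop :=
  ∃ κ c C : ℝ, 0 < κ ∧ 0 < c ∧ ∀ a : ℝ, 19 / 20 ≤ a → a ≤ 1 → ∃ hₐ w₀ : ℝ, 3 / 4 ≤ hₐ ∧
    (∀ q : E3, 0 < q 2 → (∀ z ∈ layer a, 7 / 10 ≤ dist q z) → w₀ ≤ adsorption a q) ∧
    ∀ (ρ : ℝ) (n : ℕ) (y : Fin n → E3), 1 ≤ ρ →
      (∀ i, 0 < y i 2 ∧ y i 2 ≤ 3 / 2 ∧ ‖proj (y i)‖ ≤ ρ) →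
      (∀ i j, i ≠ j → 7 / 10 ≤ dist (y i) (y j)) →
      (∀ i, ∀ z ∈ layer a, 7 / 10 ≤ dist (y i) z) →
        (n : ℝ) * (w₀ + inplaneHalfSum a) - C * ρ
          + κ * (Nat.card {i : Fin n //
                a / 8 ≤ Metric.infDist (proj (y i)) (hollows a) ∨ a / 8 ≤ |y i 2 - hₐ|} : ℝ)
          + c * (∑ i, if Metric.infDist (proj (y i)) (hollows a) < a / 8 ∧ |y i 2 - hₐ| < a / 8
                then Metric.infDist (proj (y i)) (hollows a) ^ 2 + (y i 2 - hₐ) ^ 2 else 0)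
          ≤ (∑ i, adsorption a (y i)) + interactionEnergy lennardJones y

/-- SEED LAYERS (the bet of card `epitaxial-half-space-gap`): for every disc radius `L'` and
tolerances `η₀, ε > 0`, frequently in `N`, some particle `i` of the ground state and some linear
isometry `A` see, in the slab `|x₂| ≤ η₀` over the lateral disc of radius `L'` about `x_i`, an
`η₀`-perturbed rigid triangular patch of spacing `a ∈ [0.95, 1]` (two-way matched) — ONE
close-packed plane, nothing asked off the slab — inside an `ε`-optimal, 7/10-separated `L'`-ball. -/
def SeedLayers : Prop :=
  ∀ x : (N : ℕ) → (Fin N → E3), (∀ N, IsGroundState lennardJones (x N)) →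
    ∀ L' η₀ ε : ℝ, 0 < L' → 0 < η₀ → 0 < ε → ∃ᶠ N in atTop,
      ∃ (i : Fin N) (A : E3 →ₗᵢ[ℝ] E3) (a : ℝ), 19 / 20 ≤ a ∧ a ≤ 1 ∧
        (∀ z ∈ layer a, ‖z‖ ≤ L' → ∃ j : Fin N, dist (A (x N j - x N i)) z ≤ η₀) ∧
        (∀ j : Fin N, ‖proj (A (x N j - x N i))‖ ≤ L' → |(A (x N j - x N i)) 2| ≤ η₀ →
            ∃ z ∈ layer a, dist (A (x N j - x N i)) z ≤ η₀) ∧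
        (∀ j k : Fin N, j ≠ k → dist (x N j) (x N i) ≤ L' → dist (x N k) (x N i) ≤ L' →
            (7 : ℝ) / 10 ≤ dist (x N j) (x N k)) ∧
        (∑ j : Fin N, ∑ k : Fin N,
            if j ≠ k ∧ dist (x N j) (x N i) ≤ L' ∧ dist (x N k) (x N i) ≤ L'
            then lennardJones (dist (x N j) (x N k)) else 0)
          ≤ 2 * (eStar + ε) * (Nat.card {j : Fin N // dist (x N j) (x N i) ≤ L'} : ℝ)

/-- The shape of the epitaxy line's composition (to be PROVED at crux-plan, not here):
seed + slab gap + cut-and-paste budget + pigeonhole give rigid near-optimal Barlow windows,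
hence (by `WindowsGlue`) the crux. -/
def EpitaxyComposition : Prop :=
  SeedLayers → HalfSpaceEpitaxialGap → RigidOptimalBarlowWindows

end Summit.AtomisticToContinuum.Crystallization.Cruxes.LjLaminarWindows.IdeatorOne

end
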